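import Summits.ResolutionOfSingularities.ResolutionOfSingularities.Theorems.HomologicalConductorNoZenoVmaxCofinal
import Summits.ResolutionOfSingularities.ResolutionOfSingularities.Theorems.HomologicalConductorNoZenoZariskiDescent
import HarnessLib

/-!
# Crux `NoZenoR` / `NoZeno` (stmt-ResolutionOfSingularities-19943 / -16483) — the PRINCIPALIZATION CRITERION and the
# RESIDUAL INEQUALITY at a non-principalizing step of an eternal thread

Route `ResolutionOfSingularities/HomologicalConductor`, W4.4 chain, line `thread-composite` r1.5/r1.6 §1e′ (author
res-L0-w44-strat-1 g13, `L/res-L0-w44-strat-1/line-thread-composite-r1.lean` r1.6, sorry-free there; res-L0-w44-plan-1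
CHAIN v27 row stub-3 (o2) GO, RULING (ρ41b)/(ρ41b′) «RESIDUAL INEQUALITY»): the TREE HOME, DEF-FREE, of

* `principalizes_of_vmax_of_mul_mem_span` — (P) Zariski's denominator descent INSIDE the thread: at stage `n+1` let
  `y ∈ ca(T_(n+1))`, `y ≠ 0`, be `V`-minimal within `ca(T_(n+1))`, `V` dominating the germ `D_(n+2)`; if some `m` with
  `V.valuation y < V.valuation m` multiplies every `V`-non-unit of `D_(n+1)` into the `D_(n+2)`-span of `ca(T_(n+1))`,
  then step `n` PRINCIPALIZES at `V` (tree `Zariski.Principalizes`, p542507) with `g = y·m⁻¹` — over (R1)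
  `CompositeDominator.mul_inv_mem_germ_of_vmax` (p552231).
* `exists_mul_not_mem_span_of_not_principalizes` — (P′) the contrapositive: the base-point habitat `¬ Principalizes`
  in DEPTH form.
* `valuation_pow_le_of_not_principalizes` — (P″) the RESIDUAL INEQUALITY in valuation form: at a non-principalizing
  step, `z ^ r · 𝔪_(D_(n+1)) ⊆ J_n·D_(n+2)` forces `V.valuation (z ^ r) ≤ V.valuation y` (additively `r·ord_V z ≥ ord_V J_n`).

The thread germ `germ O A P hP i` of the line is spelled `Parasite.locPrime (tower O A (i + 1)) (P (i + 1)) (hP (i + 1))`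
(definitionally equal), so the `Zariski.Principalizes` chain argument is
`fun i => Parasite.locPrime (tower O A (i + 1)) (P (i + 1)) (hP (i + 1))`; binder order = the line's (drop-in names for
r1.7 «pure imports»).  OURS (cell res-hironaka): AI-produced and kernel-checked, weaker than expert review; nothing here
is a statement of the manuscript under review (Hironaka 2017); fact-free, counted 0.
-/

noncomputable section

-- single-problem summit: the doubled namespace component `ResolutionOfSingularities` is forced
set_option linter.dupNamespace false

namespace Summit.ResolutionOfSingularities.ResolutionOfSingularities.Theorems.NoZeno.CompositeDominator

open IsLocalRing
open Summit.ResolutionOfSingularities.ResolutionOfSingularities.Theses.HomologicalConductor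
open Summit.ResolutionOfSingularities.ResolutionOfSingularities.Theorems.NoZeno.Birth
open Summit.ResolutionOfSingularities.ResolutionOfSingularities.Theorems.NoZeno
open Summit.ResolutionOfSingularities.ResolutionOfSingularities.Theorems.NoZeno.ZariskiDescent
open Literature.AlgebraicGeometry.Resolution

variable {k K : Type} [Field k] [Field K] [Algebra k K]

/-! ## (P) The principalization criterion -/

open Summit.ResolutionOfSingularities.ResolutionOfSingularities.Theorems.NoZeno.SandwichCluster in
/-- **(P) PRINCIPALIZATION CRITERION** (res-L0-w44-strat-1, `thread-composite` r1.5 §1e′).  At stage `n+1` let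
`y ∈ ca(T_(n+1))`, `y ≠ 0`, be `V`-minimal WITHIN `ca(T_(n+1))` (so by (R1) `mul_inv_mem_germ_of_vmax` every ratio
`y'·y⁻¹`, `y' ∈ ca(T_(n+1))`, lies in the germ `D_(n+2)`), `V` dominating `D_(n+2)`.  If some `m ∈ K` with
`V.valuation y < V.valuation m` multiplies every `V`-non-unit of `D_(n+1)` into the `D_(n+2)`-span of `ca(T_(n+1))`
— e.g. `m = x₀^(r-1)` for a `V`-minimal `x₀ ∈ 𝔪_(D_(n+1))` whenever `𝔪_(D_(n+1))^r ⊆ J_n·D_(n+2)` and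
`(r-1)·ord_V 𝔪_(D_(n+1)) < ord_V J_n` — then step `n` PRINCIPALIZES at `V` (`Zariski.Principalizes`) with `g = y·m⁻¹`.
Zariski's own case `J_n = 𝔪`, `r = 1` always principalizes — which is why blowing up CENTRES uniformises `V`.
[this work; elementary over (R1)] -/
theorem principalizes_of_vmax_of_mul_mem_span (O : ValuationSubring K) (A : Subalgebra k K)
    (hk : ∀ c : k, algebraMap k K c ∈ O) (hA : A.FG) (hfr : IsFractionRing ↥A K)
    (hAO : A.toSubring ≤ O.toSubring)
    (P : ∀ m : ℕ, Ideal ↥(tower O A m)) (hP : ∀ m, (P m).IsPrime) (V : ValuationSubring K) (n : ℕ)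
    (hdom : SubringDominates (Parasite.locPrime (tower O A (n + 1 + 1)) (P (n + 1 + 1)) (hP (n + 1 + 1)))
      V.toSubring)
    {y : K} (hy : y ∈ ca (tower O A (n + 1))) (hy0 : y ≠ 0)
    (hvmax : ∀ x ∈ ca (tower O A (n + 1)), V.valuation x ≤ V.valuation y)
    {m : K} (hmy : V.valuation y < V.valuation m)
    (hdepth : ∀ x ∈ Parasite.locPrime (tower O A (n + 1)) (P (n + 1)) (hP (n + 1)), V.valuation x < 1 →
      m * x ∈ Submodule.span ↥(Parasite.locPrime (tower O A (n + 1 + 1)) (P (n + 1 + 1)) (hP (n + 1 + 1)))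
        (ca (tower O A (n + 1)))) :
    Zariski.Principalizes (fun i => Parasite.locPrime (tower O A (i + 1)) (P (i + 1)) (hP (i + 1))) V n := by
  have hm0 : m ≠ 0 := by
    rintro rfl
    rw [map_zero] at hmy
    exact (not_lt.mpr zero_le) hmy
  have hvm : V.valuation m ≠ 0 := by
    rw [ne_eq, Valuation.zero_iff]
    exact hm0
  -- every element of the `D_(n+2)`-span of `ca(T_(n+1))`, divided by `y`, lies in `D_(n+2)` (by (R1))
  have hdiv : ∀ z ∈ Submodule.span ↥(Parasite.locPrime (tower O A (n + 1 + 1)) (P (n + 1 + 1)) (hP (n + 1 + 1)))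
      (ca (tower O A (n + 1))),
      z * y⁻¹ ∈ Parasite.locPrime (tower O A (n + 1 + 1)) (P (n + 1 + 1)) (hP (n + 1 + 1)) := by
    intro z hz
    induction hz using Submodule.span_induction with
    | mem w hw => exact mul_inv_mem_germ_of_vmax O A hk hA hfr hAO P hP V n hdom hy hy0 hvmax hw
    | zero => rw [zero_mul]; exact Subring.zero_mem _
    | add u w _ _ hu hw => rw [add_mul]; exact Subring.add_mem _ hu hw
    | smul a w _ hw =>
        rw [Algebra.smul_def, mul_assoc]
        exact Subring.mul_mem _ a.2 hw
  refine ⟨y * m⁻¹, ?_, fun x hx hvx => ⟨m * x * y⁻¹, hdiv _ (hdepth x hx hvx), ?_⟩⟩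
  · rw [map_mul, map_inv₀]
    calc V.valuation y * (V.valuation m)⁻¹ < V.valuation m * (V.valuation m)⁻¹ :=
          mul_lt_mul_of_pos_right hmy (inv_pos.mpr (zero_lt_iff.mpr hvm))
      _ = 1 := mul_inv_cancel₀ hvm
  · rw [show y * m⁻¹ * (m * x * y⁻¹) = x * (m * m⁻¹) * (y * y⁻¹) by ring, mul_inv_cancel₀ hm0,
      mul_inv_cancel₀ hy0, mul_one, mul_one]

/-! ## (P′) The base-point habitat in depth form -/

open Summit.ResolutionOfSingularities.ResolutionOfSingularities.Theorems.NoZeno.SandwichCluster in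
/-- **(P′) THE BASE-POINT HABITAT IN DEPTH FORM** (res-L0-w44-strat-1, `thread-composite` r1.5 §1e′; contrapositive of
(P)).  At a non-principalizing step `n` (the BP binder past `N`): for every `V`-minimal `y ∈ ca(T_(n+1))` and every `m`
with `V.valuation y < V.valuation m`, some `V`-non-unit `x` of `D_(n+1)` has `m·x` OUTSIDE the `D_(n+2)`-span of
`ca(T_(n+1))` — in particular (take `m = x₀^(r-1)`) no power `𝔪_(D_(n+1))^r` with `(r-1)·ord_V 𝔪_(D_(n+1)) < ord_V y`
lies in `J_n·D_(n+2)`. [this work; composition only] -/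
theorem exists_mul_not_mem_span_of_not_principalizes (O : ValuationSubring K) (A : Subalgebra k K)
    (hk : ∀ c : k, algebraMap k K c ∈ O) (hA : A.FG) (hfr : IsFractionRing ↥A K)
    (hAO : A.toSubring ≤ O.toSubring)
    (P : ∀ m : ℕ, Ideal ↥(tower O A m)) (hP : ∀ m, (P m).IsPrime) (V : ValuationSubring K) (n : ℕ)
    (hdom : SubringDominates (Parasite.locPrime (tower O A (n + 1 + 1)) (P (n + 1 + 1)) (hP (n + 1 + 1)))
      V.toSubring)
    (hnp : ¬ Zariski.Principalizes
      (fun i => Parasite.locPrime (tower O A (i + 1)) (P (i + 1)) (hP (i + 1))) V n)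
    {y : K} (hy : y ∈ ca (tower O A (n + 1))) (hy0 : y ≠ 0)
    (hvmax : ∀ x ∈ ca (tower O A (n + 1)), V.valuation x ≤ V.valuation y)
    {m : K} (hmy : V.valuation y < V.valuation m) :
    ∃ x ∈ Parasite.locPrime (tower O A (n + 1)) (P (n + 1)) (hP (n + 1)), V.valuation x < 1 ∧
      m * x ∉ Submodule.span ↥(Parasite.locPrime (tower O A (n + 1 + 1)) (P (n + 1 + 1)) (hP (n + 1 + 1)))
        (ca (tower O A (n + 1))) := by
  by_contra h
  push Not at h
  exact hnp (principalizes_of_vmax_of_mul_mem_span O A hk hA hfr hAO P hP V n hdom hy hy0 hvmax hmy h)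

/-! ## (P″) The residual inequality in valuation form -/

open Summit.ResolutionOfSingularities.ResolutionOfSingularities.Theorems.NoZeno.SandwichCluster in
/-- **(P″) THE RESIDUAL INEQUALITY (RI) IN VALUATION FORM** (res-L0-w44-strat-1, `thread-composite` r1.6 §1e′;
res-L0-w44-plan-1 (ρ41b)/(ρ41b′)).  At a non-principalizing step `n`, if `z ^ r` multiplies every `V`-non-unit of
`D_(n+1)` into the `D_(n+2)`-span of `ca(T_(n+1))` (e.g. `z ∈ 𝔪_(D_(n+1))` and `𝔪_(D_(n+1))^(r+1) ⊆ J_n·D_(n+2)`), then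
`V.valuation (z ^ r) ≤ V.valuation y` for every `V`-minimal `y ∈ ca(T_(n+1))`; additively `r · ord_V z ≥ ord_V J_n`.
READING (`a_n = ord_V J_n ≥ a_∞`, `b_n = ord_V 𝔪_(D_(n+1)) ↓ b_∞ ≥ 1`, `r_n = min{r : 𝔪^r ⊆ J_n·D_(n+2)}`):
`(r_n − 1)·b_n ≥ a_n` at EVERY stage `n ≥ N`, hence `r_n ≥ 2` at every late stage and `r_n = 2` forces
`a_n = a_∞ = b_∞`. [this work; contrapositive of (P)] -/
theorem valuation_pow_le_of_not_principalizes (O : ValuationSubring K) (A : Subalgebra k K)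
    (hk : ∀ c : k, algebraMap k K c ∈ O) (hA : A.FG) (hfr : IsFractionRing ↥A K)
    (hAO : A.toSubring ≤ O.toSubring)
    (P : ∀ m : ℕ, Ideal ↥(tower O A m)) (hP : ∀ m, (P m).IsPrime) (V : ValuationSubring K) (n : ℕ)
    (hdom : SubringDominates (Parasite.locPrime (tower O A (n + 1 + 1)) (P (n + 1 + 1)) (hP (n + 1 + 1)))
      V.toSubring)
    (hnp : ¬ Zariski.Principalizes
      (fun i => Parasite.locPrime (tower O A (i + 1)) (P (i + 1)) (hP (i + 1))) V n)
    {y : K} (hy : y ∈ ca (tower O A (n + 1))) (hy0 : y ≠ 0)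
    (hvmax : ∀ x ∈ ca (tower O A (n + 1)), V.valuation x ≤ V.valuation y)
    {z : K} {r : ℕ}
    (hdepth : ∀ x ∈ Parasite.locPrime (tower O A (n + 1)) (P (n + 1)) (hP (n + 1)), V.valuation x < 1 →
      z ^ r * x ∈ Submodule.span ↥(Parasite.locPrime (tower O A (n + 1 + 1)) (P (n + 1 + 1)) (hP (n + 1 + 1)))
        (ca (tower O A (n + 1)))) :
    V.valuation (z ^ r) ≤ V.valuation y := by
  by_contra h
  push Not at h
  exact hnp (principalizes_of_vmax_of_mul_mem_span O A hk hA hfr hAO P hP V n hdom hy hy0 hvmax h hdepth)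

end Summit.ResolutionOfSingularities.ResolutionOfSingularities.Theorems.NoZeno.CompositeDominator

end
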